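import Summits.BirchSwinnertonDyer.Rank1Residual.GaloisImage.PrimeChoiceSakamotoTorsion
import Summits.BirchSwinnertonDyer.Rank1Residual.GaloisImage.PrimeChoiceSelectionIndependent
import HarnessLib

/-!
# Sakamoto's Lemma 5.2 as a THEOREM: infinitely many good Kolyvagin primes for an INDEPENDENT
# family of classes plus one more (cell `b2b-bsdres`, team n1011, row T-C55K-4 = appendix of
# T-C55K for route planner 1's R1-56 "S24(1)@m=1 in the kernel" — the Chebotarev input of [S24]
# Lemma 6.4 (connectedness of the core graph `𝒳⁰`, K3); file C — CHEBOTAREV + END; seat p15)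

HONEST FRAMING (cell `b2b-bsdres`, run/shared/lean/b2b/bsd-rank1-residual/, verbatim in every
file): the goal of the cell is to DELETE the COMBINATION-SHAPED residual classes of the
Birch–Swinnerton-Dyer formula for ALL analytic-rank `≤ 1` elliptic curves over `ℚ` — "full BSD
formula for every rank `≤ 1` curve in class `C`" assembled STRICTLY from published theorems — so
that the rank-`≤ 1` remainder becomes exactly the CONSTRUCTION-SHAPED classes, which are TYPED
(missing-input `Prop`s), NOT attempted. This is not "finishing BSD". Team n1011 (N10/N11, the
additive block `X4 ∧ p = 3`): research route; TOOL theorems of Galois cohomology, no class theorem,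
nothing booked, no mark changed; no definition, no named fact, no `sorry`.

## What and why

[S24] Remark 5.4: "Lemma 5.2 is only used to prove Corollary 5.5 and Lemma 6.4."  Cor. 5.5 (three
arbitrary classes) is T-C55K's `infinite_setOf_mem_frobeniusClassPrimes_forall_localization_ne_zero`
(p271663).  Lemma 6.4 — two core vertices `d₁, d₂` of minimal `ν` and primes `qᵢ ∣ dᵢ` admit
infinitely many `q` with paths `dᵢ → dᵢq/qᵢ` in `𝒳⁰`, the step from which Cor. 6.6 and Thm. 6.7
("the graph `𝒳⁰` is connected") follow — needs LEMMA 5.2: FOUR non-zero classes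
`c₁⁽¹⁾, c₂⁽¹⁾, c₁⁽²⁾, c₂⁽²⁾` with `dim_𝔽₃(span) ≥ 3` have a common `q ∈ 𝒫` with all `loc_q ≠ 0`
(Remark 5.3: false for dimension `2`, so no "`n ≤ p`" statement serves).  This file proves it, for
every odd `p`, in the form Lemma 6.4 uses ("three of the four classes are independent"):

* `exists_mem_frobeniusClassPrimes_notMem_of_selection` — T-C55K file 4's Chebotarev Steps 2–4,
  FACTORED: given `γ ∈ G_F` with `cᵢ(τγ) ∉ (τ − 1)T̄` for a finite family of cocycles (however
  selected), there is `𝔮 ∈ frobeniusClassPrimes ρ S τ N` outside any finite `T` with every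
  `loc_𝔮 [cᵢ] ≠ 0` (the open set `U ∋ τγ`, a Frobenius in `U` by the tree's PROVED Chebotarev
  `frobenius_dense`, file 3's local criterion) — proof verbatim from p271663, nothing there edited;
* `infinite_setOf_mem_frobeniusClassPrimes_localization_ne_zero_of_linearIndependent` — for classes
  `cᵢ ∈ H¹(K, T̄)` `𝔽_p`-LINEARLY INDEPENDENT (`Σ ãᵢ cᵢ = 0 ⟹ a = 0`, `ℕ`-multiples) and one more
  class `c′ ≠ 0`, under (H.1), (H.3), `T̄/(τ − 1)T̄ ≃ ℤ/p`, `p ≥ 3`: infinitely many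
  `𝔮 ∈ frobeniusClassPrimes ρ S τ N` with every `loc_𝔮 cᵢ ≠ 0` and `loc_𝔮 c′ ≠ 0`;
* `infinite_setOf_mem_frobeniusClassPrimes_localization_ne_zero_four` — **Sakamoto's Lemma 5.2 in
  Lemma 6.4's form**: `c₁, c₂, c₃` independent, `c₄ ≠ 0`;
* `…_torsion_of_linearIndependent` / `…_torsion_four` — the `E[p]` reading over `ℚ`, `p` odd,
  `ρ̄_{E,p}` onto ((H.1)/(H.3) from surjectivity as in T-C55K file 5).

References: R. Sakamoto, JTNB **36** (2024), Lemma 5.1, Lemma 5.2, Remarks 5.3–5.4, Cor. 5.5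
(pp. 927–930), Lemma 6.4, Cor. 6.6, Thm. 6.7 (pp. 931–932) [Sakamoto2024]; B. Mazur, K. Rubin,
Mem. AMS **799** (2004), Prop. 3.6.1 (pp. 30–31), Prop. 4.3.11 [MazurRubin2004]; J. Tate, *Global
class field theory* §2.4 (Chebotarev).
-/

noncomputable section

open Function Field NumberField IsDedekindDomain Filter Topology
open Literature.NumberTheory.GaloisRepresentations Literature.NumberTheory.GaloisCohomology
open scoped NumberField Pointwise

namespace Summit.BirchSwinnertonDyer.Rank1Residual.GaloisImage.PrimeChoice

section General

variable {K : Type} [Field K] [NumberField K] {M : Type} [AddCommGroup M] [TopologicalSpace M]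
  [DiscreteTopology M] (ρ : DiscreteGaloisModule K M)

/-- **Chebotarev step, factored** (T-C55K file 4's Steps 2–4): if `γ ∈ G_F` (`ρ γ = 1`,
`γ ∈ Gal(K̄/K(μ_N))`) satisfies `cᵢ(τγ) ∉ (τ − 1)T̄` for a finite family of continuous crossed
homomorphisms `cᵢ`, then outside any finite set `T` there is `𝔮 ∈ frobeniusClassPrimes ρ S τ N`
with `loc_𝔮 [cᵢ] ≠ 0` for every `i`: the conditions "`ρ σ = ρ(τγ)` on `T̄`", "`σ = τγ` on `μ_N`",
"`cᵢ σ = cᵢ(τγ)`" cut out an open `U ∋ τγ`; the tree's proved Chebotarev (`frobenius_dense`) gives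
a Frobenius `σ ∈ U` at a place `v` off the finitely many bad places; then `v ∈ 𝒫` and
`loc_v [cᵢ] ≠ 0` by file 3's criterion `loc_v [c] = 0 ↔ c(Frob_v) ∈ (Frob_v − 1)T̄`.
[cite: Sakamoto2024, Lemma 5.2, proof (pp. 928–929)] [cite: MazurRubin2004, Prop. 3.6.1 proof, pp. 30–31] -/
theorem exists_mem_frobeniusClassPrimes_notMem_of_selection [Finite M] {N : ℕ} (hN : N ≠ 0)
    (S : Set (HeightOneSpectrum (𝓞 K))) (hS : S.Finite) (τ : absoluteGaloisGroup K)
    {ι : Type*} [Finite ι] (c : ι → contOneCocycles ρ.toTopRep)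
    {γ : absoluteGaloisGroup K} (hγρ : ρ γ = 1) (hγμ : γ ∈ rootsOfUnityFixer K N)
    (hγ : ∀ i, (c i).1 (τ * γ) ∉ ((ρ τ).toAddMonoidHom - AddMonoidHom.id M).range)
    (T : Set (HeightOneSpectrum (𝓞 K))) (hT : T.Finite) :
    ∃ q ∈ frobeniusClassPrimes ρ S τ N, q ∉ T ∧
      ∀ i, galoisCohomology.localization ρ (Sum.inr q) 1 (oneCocycleClass ρ.toTopRep (c i)) ≠ 0 := by
  classical
  set g₀ : absoluteGaloisGroup K := τ * γ with hg₀
  have hρg₀ : ρ g₀ = ρ τ := by rw [hg₀, map_mul, hγρ, mul_one]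
  -- the open set `U ∋ g₀`
  set U : Set (absoluteGaloisGroup K) :=
    {σ | (∀ m : M, ρ σ m = ρ g₀ m) ∧
      (∀ t : AlgebraicClosure K, t ^ N = 1 → σ • t = g₀ • t) ∧ ∀ i, (c i).1 σ = (c i).1 g₀}
    with hU_def
  haveI : NeZero N := ⟨hN⟩
  haveI : NeZero (N : K) := ⟨Nat.cast_ne_zero.mpr hN⟩
  have hUopen : IsOpen U := by
    have h1 : IsOpen {σ : absoluteGaloisGroup K | ∀ m : M, ρ σ m = ρ g₀ m} := by
      have heq : {σ : absoluteGaloisGroup K | ∀ m : M, ρ σ m = ρ g₀ m} =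
          (fun σ => g₀⁻¹ * σ) ⁻¹' ⋂ m : M, {σ | ρ σ m = m} := by
        ext σ
        simp only [Set.mem_setOf_eq, Set.mem_preimage, Set.mem_iInter, map_mul,
          Module.End.mul_apply]
        refine forall_congr' fun m => ⟨fun h => ?_, fun h => ?_⟩
        · rw [h, ← Module.End.mul_apply, ← map_mul, inv_mul_cancel, map_one, Module.End.one_apply]
        · have h' := congrArg (ρ g₀) h
          rwa [← Module.End.mul_apply, ← map_mul, mul_inv_cancel, map_one, Module.End.one_apply] at h'
      rw [heq]
      exact (isOpen_iInter_of_finite fun m => ρ.isOpen_setOf_apply_eq m).preimage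
        (continuous_const.mul continuous_id)
    have h2 : IsOpen {σ : absoluteGaloisGroup K | ∀ t : AlgebraicClosure K, t ^ N = 1 → σ • t = g₀ • t} := by
      have heq : {σ : absoluteGaloisGroup K | ∀ t : AlgebraicClosure K, t ^ N = 1 → σ • t = g₀ • t} =
          (fun σ => g₀⁻¹ * σ) ⁻¹' (rootsOfUnityFixer K N : Set (absoluteGaloisGroup K)) := by
        ext σ
        simp only [Set.mem_setOf_eq, Set.mem_preimage, SetLike.mem_coe, mem_rootsOfUnityFixer_iff,
          mul_smul, inv_smul_eq_iff]
      rw [heq]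
      exact (isOpen_rootsOfUnityFixer K N).preimage (continuous_const.mul continuous_id)
    have h3 : IsOpen {σ : absoluteGaloisGroup K | ∀ i, (c i).1 σ = (c i).1 g₀} := by
      have heq : {σ : absoluteGaloisGroup K | ∀ i, (c i).1 σ = (c i).1 g₀} =
          ⋂ i, (c i).1 ⁻¹' {(c i).1 g₀} := by
        ext σ; simp [Set.mem_iInter]
      rw [heq]
      exact isOpen_iInter_of_finite fun i => (isOpen_discrete _).preimage (c i).1.continuous
    simpa only [hU_def, Set.setOf_and] using h1.inter (h2.inter h3)
  have hg₀U : g₀ ∈ U := ⟨fun _ => rfl, fun _ _ => rfl, fun _ => rfl⟩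
  -- the finite set of bad places and a Frobenius in `U` away from it
  set B : Set (HeightOneSpectrum (𝓞 K)) :=
    S ∪ T ∪ {v | ((N : ℕ) : 𝓞 K) ∈ v.asIdeal} ∪ {v | ¬ GaloisRep.IsUnramifiedAt v ρ} ∪
      {v | ¬ ∀ i, ∀ 𝔓 ∈ v.primesAbove, ∀ g ∈ 𝔓.inertia (absoluteGaloisGroup K), (c i).1 g = 0}
    with hB_def
  have hBfin : B.Finite := by
    refine (((hS.union hT).union (finite_setOf_natCast_mem (K := K) (m := N))).union ?_).union ?_
    · exact eventually_cofinite.1 (eventually_isUnramifiedAt ρ)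
    · exact eventually_cofinite.1
        (eventually_all.2 fun i => eventually_forall_inertia_apply_eq_zero ρ (c i))
  have hdense := absoluteGaloisGroup.frobenius_dense
    Literature.NumberTheory.Automorphic.chebotarev_artinRep_of_galoisSide K B hBfin
  obtain ⟨σ, ⟨v, hvB, 𝔓, h𝔓, hσ𝔓⟩, hσU⟩ := hdense.exists_mem_open hUopen ⟨g₀, hg₀U⟩
  simp only [hB_def, Set.mem_union, Set.mem_setOf_eq, not_or, not_not] at hvB
  obtain ⟨⟨⟨⟨hvS, hvT⟩, hvN⟩, hunr⟩, hcI⟩ := hvB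
  obtain ⟨hσρ, hσμ, hσc⟩ := hσU
  have hρσ : ρ σ = ρ τ := (LinearMap.ext hσρ).trans hρg₀
  -- `v ∈ 𝒫` and the localisations are non-zero
  refine ⟨v, ⟨hvS, hvN, hunr, σ, ⟨𝔓, h𝔓, hσ𝔓⟩, fun m => ?_, fun ζ hζ => ?_⟩, hvT, fun i => ?_⟩
  · rw [map_mul, hρσ, ← map_mul, mul_inv_cancel, map_one, Module.End.one_apply]
  · have hζ' : (τ⁻¹ • ζ) ^ N = 1 := by rw [← smul_pow', hζ, smul_one]
    rw [mul_smul, hσμ _ hζ', hg₀, mul_smul, (mem_rootsOfUnityFixer_iff.mp hγμ) _ hζ',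
      smul_inv_smul]
  · rw [Ne, localization_oneCocycleClass_eq_zero_iff_of_isArithFrobAt ρ v hunr (c i) (hcI i) h𝔓 hσ𝔓,
      hσc i, hρσ]
    exact hγ i

/-- **Sakamoto's Lemma 5.2 (THEOREM), in the form Lemma 6.4 uses.**  For a number field `K`, a
finite discrete `Γ_K`-module `T̄` with (H.1) and (H.3) (tree shapes), `τ` with
`T̄/(τ − 1)T̄ ≃ ℤ/p`, `p ≥ 3`, `N ≠ 0`, `S` finite, an `𝔽_p`-LINEARLY-INDEPENDENT family of classes
`cᵢ ∈ H¹(K, T̄)` (`Σ ãᵢ cᵢ = 0 ⟹ a = 0`) and one more class `c′ ≠ 0`: **infinitely many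
`𝔮 ∈ frobeniusClassPrimes ρ S τ N` have `loc_𝔮 cᵢ ≠ 0` for every `i` and `loc_𝔮 c′ ≠ 0`.**
(File B's selection + `exists_mem_frobeniusClassPrimes_notMem_of_selection`.)
[cite: Sakamoto2024, Lemma 5.2 (p. 928) and Lemma 6.4 (pp. 931–932)]
[cite: MazurRubin2004, Prop. 3.6.1 (pp. 30–31)] -/
theorem infinite_setOf_mem_frobeniusClassPrimes_localization_ne_zero_of_linearIndependent [Finite M]
    {p : ℕ} [Fact p.Prime] (hp : 3 ≤ p) {N : ℕ} (hN : N ≠ 0)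
    (S : Set (HeightOneSpectrum (𝓞 K))) (hS : S.Finite)
    {τ : absoluteGaloisGroup K} (hτ : Nonempty (cokerSubOne ρ τ ≃+ ZMod p))
    (hirr : ∀ A : AddSubgroup M,
      (∀ (s : absoluteGaloisGroup K), ∀ m ∈ A, ρ s m ∈ A) → A = ⊥ ∨ A = ⊤)
    (hH3 : ∀ f : contOneCocycles ρ.toTopRep,
      (∀ u : absoluteGaloisGroup K, ρ u = 1 → u ∈ rootsOfUnityFixer K N → f.1 u = 0) →
        oneCocycleClass ρ.toTopRep f = 0)
    {ι : Type*} [Fintype ι] [DecidableEq ι] (c : ι → galoisCohomology ρ 1)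
    (hind : ∀ a : ι → ZMod p, (∑ i, (a i).val • c i) = 0 → a = 0)
    (c' : galoisCohomology ρ 1) (hc' : c' ≠ 0) :
    {q | q ∈ frobeniusClassPrimes ρ S τ N ∧
      (∀ i, galoisCohomology.localization ρ (Sum.inr q) 1 (c i) ≠ 0) ∧
      galoisCohomology.localization ρ (Sum.inr q) 1 c' ≠ 0}.Infinite := by
  classical
  choose φ hφ using fun i => oneCocycleClass_surjective ρ.toTopRep (c i)
  obtain ⟨φ', hφ'⟩ := oneCocycleClass_surjective ρ.toTopRep c'
  have hcφ : c = fun i => (oneCocycleClass ρ.toTopRep (φ i) : galoisCohomology ρ 1) :=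
    funext fun i => (hφ i).symm
  subst hcφ
  have hindφ : ∀ a : ι → ZMod p, (∑ i, (a i).val • oneCocycleClass ρ.toTopRep (φ i)) = 0 → a = 0 :=
    fun a ha => hind a ha
  have hφ'ne : oneCocycleClass ρ.toTopRep φ' ≠ 0 := by rw [hφ']; exact hc'
  -- file B: the selection for the family `φ` and the extra cocycle `φ′`, packaged on `Option ι`
  obtain ⟨γ, hγρ, hγμ, hγ, hγ'⟩ :=
    exists_forall_apply_mul_notMem_range_of_linearIndependent hp hτ.some hirr hH3 φ hindφ φ' hφ'ne
  let d : Option ι → contOneCocycles ρ.toTopRep := fun o => o.elim φ' φ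
  have hγd : ∀ o, (d o).1 (τ * γ) ∉ ((ρ τ).toAddMonoidHom - AddMonoidHom.id M).range := by
    intro o
    cases o with
    | none => exact hγ'
    | some i => exact hγ i
  intro hfin
  obtain ⟨q, hq, hqT, hloc⟩ :=
    exists_mem_frobeniusClassPrimes_notMem_of_selection ρ hN S hS τ d hγρ hγμ hγd _ hfin
  exact hqT ⟨hq, fun i => hloc (some i), by rw [← hφ']; exact hloc none⟩

/-- **Sakamoto's Lemma 5.2 at four classes** (the instance of Lemma 6.4: `c₁, c₂, c₃` independent,
`c₄ ≠ 0` — "`dim_𝔽₃(𝔽₃c₁ + 𝔽₃c₂ + 𝔽₃c₃ + 𝔽₃c₄) ≥ 3`"): infinitely many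
`𝔮 ∈ frobeniusClassPrimes ρ S τ N` with `loc_𝔮 cⱼ ≠ 0` for `j = 1, 2, 3, 4`.
[cite: Sakamoto2024, Lemma 5.2 (p. 928), Remark 5.3 and Lemma 6.4 (pp. 928, 931–932)] -/
theorem infinite_setOf_mem_frobeniusClassPrimes_localization_ne_zero_four [Finite M]
    {p : ℕ} [Fact p.Prime] (hp : 3 ≤ p) {N : ℕ} (hN : N ≠ 0)
    (S : Set (HeightOneSpectrum (𝓞 K))) (hS : S.Finite)
    {τ : absoluteGaloisGroup K} (hτ : Nonempty (cokerSubOne ρ τ ≃+ ZMod p))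
    (hirr : ∀ A : AddSubgroup M,
      (∀ (s : absoluteGaloisGroup K), ∀ m ∈ A, ρ s m ∈ A) → A = ⊥ ∨ A = ⊤)
    (hH3 : ∀ f : contOneCocycles ρ.toTopRep,
      (∀ u : absoluteGaloisGroup K, ρ u = 1 → u ∈ rootsOfUnityFixer K N → f.1 u = 0) →
        oneCocycleClass ρ.toTopRep f = 0)
    (c₁ c₂ c₃ c₄ : galoisCohomology ρ 1)
    (hind : ∀ a : Fin 3 → ZMod p, (∑ i, (a i).val • ![c₁, c₂, c₃] i) = 0 → a = 0) (hc₄ : c₄ ≠ 0) :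
    {q | q ∈ frobeniusClassPrimes ρ S τ N ∧ galoisCohomology.localization ρ (Sum.inr q) 1 c₁ ≠ 0 ∧
      galoisCohomology.localization ρ (Sum.inr q) 1 c₂ ≠ 0 ∧
      galoisCohomology.localization ρ (Sum.inr q) 1 c₃ ≠ 0 ∧
      galoisCohomology.localization ρ (Sum.inr q) 1 c₄ ≠ 0}.Infinite := by
  refine (infinite_setOf_mem_frobeniusClassPrimes_localization_ne_zero_of_linearIndependent ρ hp hN S
    hS hτ hirr hH3 ![c₁, c₂, c₃] hind c₄ hc₄).mono ?_
  rintro q ⟨hq, h, h'⟩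
  exact ⟨hq, h 0, h 1, h 2, h'⟩

end General

/-! ## The `E[p]` reading over `ℚ` -/

section Torsion

open WeierstrassCurve Literature.NumberTheory.EllipticCurves

variable (W : WeierstrassCurve ℚ) [W.IsElliptic]

/-- **Lemma 5.2 for `T̄ = E[p]`, `p` odd, `ρ̄_{E,p}` onto** — for an `𝔽_p`-independent family of
classes of `H¹(ℚ, E[p])` and one more non-zero class, infinitely many
`𝔮 ∈ frobeniusClassPrimes (E[p]) S τ p` have all `loc_𝔮 ≠ 0` ((H.1) by
`hasIrreducibleModPGaloisRep_of_hasSurjectiveModNGaloisRep`, (H.3) by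
`hH3_self_of_hasSurjectiveModNGaloisRep`, `p ≥ 3` from `p` odd).
[cite: Sakamoto2024, Lemma 5.2 (p. 928)] [cite: MazurRubin2004, Prop. 3.6.1 and Lemma 6.2.3] -/
theorem infinite_setOf_mem_frobeniusClassPrimes_localization_ne_zero_torsion_of_linearIndependent
    (p : ℕ) [Fact p.Prime] (hp2 : p ≠ 2) (hsurj : W.HasSurjectiveModNGaloisRep (p : ℤ))
    (S : Set (HeightOneSpectrum (𝓞 ℚ))) (hS : S.Finite) {τ : absoluteGaloisGroup ℚ}
    (hτ : Nonempty (cokerSubOne (W.torsionGaloisModule (p : ℤ)) τ ≃+ ZMod p))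
    {ι : Type*} [Fintype ι] [DecidableEq ι]
    (c : ι → galoisCohomology (W.torsionGaloisModule (p : ℤ)) 1)
    (hind : ∀ a : ι → ZMod p, (∑ i, (a i).val • c i) = 0 → a = 0)
    (c' : galoisCohomology (W.torsionGaloisModule (p : ℤ)) 1) (hc' : c' ≠ 0) :
    {q | q ∈ frobeniusClassPrimes (W.torsionGaloisModule (p : ℤ)) S τ p ∧
      (∀ i, galoisCohomology.localization (W.torsionGaloisModule (p : ℤ)) (Sum.inr q) 1 (c i) ≠ 0) ∧
      galoisCohomology.localization (W.torsionGaloisModule (p : ℤ)) (Sum.inr q) 1 c' ≠ 0}.Infinite := by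
  have hp : p.Prime := Fact.out
  haveI : NeZero (p : ℚ) := ⟨Nat.cast_ne_zero.mpr hp.ne_zero⟩
  haveI : Finite (geomTorsion W (p : ℤ)) :=
    finite_torsionPoints_holds W (AlgebraicClosure ℚ) (by exact_mod_cast hp.ne_zero)
  have hp3 : 3 ≤ p := by
    rcases hp.eq_two_or_odd' with h | h
    · exact absurd h hp2
    · have := hp.two_le; omega
  have hirr := hasIrreducibleModPGaloisRep_of_hasSurjectiveModNGaloisRep W p hsurj
  exact infinite_setOf_mem_frobeniusClassPrimes_localization_ne_zero_of_linearIndependent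
    (W.torsionGaloisModule (p : ℤ)) hp3 hp.ne_zero S hS hτ
    (fun A hA => hirr A fun σ P hP => hA σ P hP)
    (fun f hf => hH3_self_of_hasSurjectiveModNGaloisRep W p hp2 hsurj f hf) c hind c' hc'

/-- **Lemma 5.2 at four classes for `T̄ = E[p]`** (`ρ̄_{E,p}` onto, `p` odd): `c₁, c₂, c₃`
independent in `H¹(ℚ, E[p])`, `c₄ ≠ 0` ⟹ infinitely many `𝔮 ∈ frobeniusClassPrimes (E[p]) S τ p`
with `loc_𝔮 cⱼ ≠ 0`, `j = 1, …, 4` — the input of [S24] Lemma 6.4 on an N11 / EXOTIC row at `p = 3`.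
[cite: Sakamoto2024, Lemma 5.2 (p. 928) and Lemma 6.4 (pp. 931–932)] -/
theorem infinite_setOf_mem_frobeniusClassPrimes_localization_ne_zero_torsion_four
    (p : ℕ) [Fact p.Prime] (hp2 : p ≠ 2) (hsurj : W.HasSurjectiveModNGaloisRep (p : ℤ))
    (S : Set (HeightOneSpectrum (𝓞 ℚ))) (hS : S.Finite) {τ : absoluteGaloisGroup ℚ}
    (hτ : Nonempty (cokerSubOne (W.torsionGaloisModule (p : ℤ)) τ ≃+ ZMod p))
    (c₁ c₂ c₃ c₄ : galoisCohomology (W.torsionGaloisModule (p : ℤ)) 1)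
    (hind : ∀ a : Fin 3 → ZMod p, (∑ i, (a i).val • ![c₁, c₂, c₃] i) = 0 → a = 0) (hc₄ : c₄ ≠ 0) :
    {q | q ∈ frobeniusClassPrimes (W.torsionGaloisModule (p : ℤ)) S τ p ∧
      galoisCohomology.localization (W.torsionGaloisModule (p : ℤ)) (Sum.inr q) 1 c₁ ≠ 0 ∧
      galoisCohomology.localization (W.torsionGaloisModule (p : ℤ)) (Sum.inr q) 1 c₂ ≠ 0 ∧
      galoisCohomology.localization (W.torsionGaloisModule (p : ℤ)) (Sum.inr q) 1 c₃ ≠ 0 ∧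
      galoisCohomology.localization (W.torsionGaloisModule (p : ℤ)) (Sum.inr q) 1 c₄ ≠ 0}.Infinite := by
  refine (infinite_setOf_mem_frobeniusClassPrimes_localization_ne_zero_torsion_of_linearIndependent W p
    hp2 hsurj S hS hτ ![c₁, c₂, c₃] hind c₄ hc₄).mono ?_
  rintro q ⟨hq, h, h'⟩
  exact ⟨hq, h 0, h 1, h 2, h'⟩

end Torsion

end Summit.BirchSwinnertonDyer.Rank1Residual.GaloisImage.PrimeChoice

end
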